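import Summits.QuantumFields.YangMills.Theorems.BalabanUVNodesN22W1RelCentredHeredityAdm

/-!
# BalabanUVNodes ∕ node N22 = NE9 — THE RELATIVE-DISC CENTRED ROAD OVER THE ADMISSIBLE CLASS OF OLDER TERMS, MODULE R1bᴬ: CENTRED HEREDITY — the order-two VERTEX LETTER of every
# generated term in every young coupling w.r.t. the VERTEX TOWER, from the GUARDED per-term schemas, by the INTERPOLATION TOWER (the ADMISSIBLE-HISTORY edition of module R1b)

Cell `pub-ymgap`, HUMAN RULING D-0062 (Track A), R134 ACCELERATION re-seat `pub-ymgap-dag-n22-c` (strategy s1), generation 8, file R1bᴬ of the ADMISSIBLE-HISTORY EDITION SWEEP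
(lens «transfer» Cards T32∕T33∕T35 + Erratum E9, node00-def-W1 (R-a) ∕ W1-13, `J10-DESIGN.md` §0).  THEOREMS ONLY; imports module R1aᴬ `…N22W1RelCentredHeredityAdm` (§2
`holoBound_recTerm_ofTerms_guarded`; through it module A0 §1b `admissibleBelow_along_of_termwise_family` and R1b's §1 congruences `recTerm_ofTerms_congr_step`) BY NAME; §1∕§2 below are
PORTED with attribution from the lens's memo-side `LensTransferSketch22.lean` §3∕§4 (ym-lens-BalabanUVNodes-transfer g22, sha16 58b7be635505913f).  `--supports` K3⁷
`SpineGivenEndpointR13SepCoPH` (stmt-QuantumFields-20544) as a helper.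

WHY ∕ WHAT.  Module R1b's `centred_recTerm_ofTerms` with every older-term binder GUARDED by [I] §1 p. 263's full inductive assumption — (1.18) `A e^{−κ d}` on the tables AND «analytic
on U^c_j» (node00-def-W1 `W1.AdmHist sp A κ k′` ∕ dag-n18-c's class; spelled inline, curried, in N18's `hTan ∕ hT226` shape) — in (S-last-T′)ᴬ, (S-226-T′)ᴬ for `TF` and for the
coupling-blind centre `V` (curves: pointwise admissible + holomorphic, on EVERY open set), (S-vertex-T′)ᴬ; PLUS the termwise φ-analyticity schemas (T-an)ᴬ for `TF` at every last
coupling of the slot domain and (T-an-V)ᴬ for `V` — NEEDED HERE AND NOWHERE BELOW: the interpolation tower `TF | i := V i + (s∕ρ)·(TF i …z₀… − V i)` is a term-functional family whose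
generated terms are nobody's datum, so their field-analyticity (the guard its own schemas are applied at) must be PRODUCED — by module R1aᴬ's joint induction, fed with the interpolation
tower's (T-an), which is `V i`'s plus an entire multiple of `TF i`'s at `z₀` (§1), through module A0 §1b (dag-n18-c's heredity BY NAME on the frozen family; §2) into module
R1aᴬ's ONE guard hypothesis `hQ`.  CONCLUSION VERBATIM as R1b: at every level `j ≤ Kr`, real window
history `g`, young coupling `i < j`, `X`, `φ ∈ sp j X`, `z₀ ∈ D i` (`z₀ ≠ 0`, `Mv‖z₀‖² ≤ ½`): ‖recTerm G (↑g|i:=z₀) j X φ − recTerm G_V ↑g j X φ‖ ≤ 2·Mv·‖z₀‖²·A·e^{−κ d_j(X)} —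
UNIFORMLY IN THE AGE (growth μ = 1).  Proof = R1b's, with R1aᴬ §2 in place of R1a §2 (its `hQ` from §2 here) and the guards threaded (the Schwarz-lemma half untouched).

HONEST FRAMING.  Count-neutral by-name knit AT THE OBJECT; NOT a discharge of N22.  Every schema is a DISPLAYED hypothesis on the term functional of record, asserted nowhere;
(S-vertex-T′) is NE9's unprinted core at the last coupling in the weakest analytic currency; NE9 NOT IN PRINT for d = 4; one finite four-torus programme at fixed ε — NOT infinite
volume, NOT OS on ℝ⁴, NOT a mass gap, NOT Clay.  0 `sorry`, 0 `def`, standard axioms.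

References (TYPES only): [I] = [Balaban1987RG1] §0 p. 256, §1 p. 263 ((1.18) and the clause before it), (2.9) p. 266, (2.10) p. 267, (2.13) p. 268; [II] = [Balaban1988RG2Cluster]
(1.41) p. 11, (2.9)–(2.14) pp. 14–15, (2.26) p. 17, Lemma 3 (2.38) p. 20, (2.39)–(2.41) p. 21, p. 22.
-/

noncomputable section

namespace YMDAG.N22.W1

open Set Metric
open scoped BigOperators
open Literature.MathematicalPhysics.QuantumFieldTheory.Balaban1983to89
open Literature.MathematicalPhysics.QuantumFieldTheory.Balaban1983to89.T4Continuum (T4Family)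
open Literature.MathematicalPhysics.QuantumFieldTheory.Balaban1983to89.T4OutputRate
open Literature.MathematicalPhysics.QuantumFieldTheory.Balaban1983to89.TreeLengthTorus (TPt TDom tsys torusTreeLen torusTreeLen_nonneg)
open Literature.MathematicalPhysics.QuantumFieldTheory.Balaban1983to89.B12TreeDecay (K₀ K₀_pos)
open Literature.MathematicalPhysics.QuantumFieldTheory.Balaban1983to89.B13Lemma3TorusData (TBond)
open Literature.MathematicalPhysics.QuantumFieldTheory.Balaban1983to89.B13Lemma3TorusTerms (terms weight weight_nonneg)
open Literature.MathematicalPhysics.QuantumFieldTheory.Balaban1983to89.B13Lemma3TorusSocket (Lemma3Numerics)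
open Literature.MathematicalPhysics.QuantumFieldTheory.Balaban1983to89.Node00
open Literature.MathematicalPhysics.QuantumFieldTheory.Balaban1983to89.Node00.Sect2 (domSys domCount CPair)
open Literature.MathematicalPhysics.QuantumFieldTheory.Balaban1983to89.Node00.W1


/-! ## §1 The interpolation tower's termwise φ-analyticity: affine in the mock coupling -/

section Interpolation

variable {P : Params} {𝔸 : Type*} [NormedRing 𝔸] [NormedAlgebra ℂ 𝔸] {M : ℕ} [NeZero M] (L : ℕ) [NeZero L]

/-- **(T-an) FOR MODULE R1b's INTERPOLATION FAMILY** `TF|i := V i + (s∕ρ)·(TF i …z₀… − V i)` on the domain family `D|i := Ball` (any set of mock couplings), per step: from (T-an)[TF]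
slot-wise on `D` (used at `z₀ ∈ D i` for the step `i`) and (T-an)[V i] — φ-analyticity of the CENTRE terms at admissible older terms (inhabitant: Lemma 2 at the centred member, lens
T21∕T25).  Generic guards `Sz`, `An`.  (lens Sketch22 §3, ported with attribution.) [cite: Balaban1988RG2Cluster, Lemma 2 (1.41)-(1.43) p.11 and (2.14) p.15; Balaban1987RG1, (2.13) p.268] -/
theorem termwiseAn_interpolation (TF : GenTermFun P 𝔸 M L)
    (V : (k : ℕ) → (domSys P M (k + 1)).Dom → TermLabel P M k L → OlderTerms P 𝔸 M k → CPair P 𝔸 → ℂ)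
    (D : ℕ → Set ℂ) (sp : (j : ℕ) → (domSys P M j).Dom → Set (CPair P 𝔸))
    (Sz An : (k : ℕ) → OlderTerms P 𝔸 M k → Prop) (i : ℕ) (z₀ ρ : ℂ) (Ball : Set ℂ) (k : ℕ)
    (hTan : ∀ t ∈ D k, ∀ old : OlderTerms P 𝔸 M k, Sz k old → An k old →
      ∀ (Z : (domSys P M (k + 1)).Dom), ∀ τ ∈ terms L M Z, AnalyticOnNhd ℂ (fun φ => TF k Z τ t old φ) (sp (k + 1) Z))
    (hTan₀ : ∀ old : OlderTerms P 𝔸 M i, Sz i old → An i old →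
      ∀ (Z : (domSys P M (i + 1)).Dom), ∀ τ ∈ terms L M Z, AnalyticOnNhd ℂ (fun φ => TF i Z τ z₀ old φ) (sp (i + 1) Z))
    (hVan : ∀ old : OlderTerms P 𝔸 M i, Sz i old → An i old →
      ∀ (Z : (domSys P M (i + 1)).Dom), ∀ τ ∈ terms L M Z, AnalyticOnNhd ℂ (fun φ => V i Z τ old φ) (sp (i + 1) Z)) :
    ∀ t ∈ Function.update D i Ball k, ∀ old : OlderTerms P 𝔸 M k, Sz k old → An k old →
      ∀ (Z : (domSys P M (k + 1)).Dom), ∀ τ ∈ terms L M Z,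
        AnalyticOnNhd ℂ (fun φ => Function.update TF i (fun Z τ s old φ => V i Z τ old φ + (s / ρ) * (TF i Z τ z₀ old φ - V i Z τ old φ)) k Z τ t old φ)
          (sp (k + 1) Z) := by
  -- ported from lens Sketch22 §3 (ym-lens-BalabanUVNodes-transfer g22), with attribution
  intro t ht old hS hA Z τ hτ
  by_cases hk : k = i
  · subst hk
    rw [Function.update_self]
    exact (hVan old hS hA Z τ hτ).add (analyticOnNhd_const.mul ((hTan₀ old hS hA Z τ hτ).sub (hVan old hS hA Z τ hτ)))
  · rw [Function.update_of_ne hk]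
    rw [Function.update_of_ne hk] at ht
    exact hTan t ht old hS hA Z τ hτ

end Interpolation

/-! ## §2 The guard for R1aᴬ's run on the interpolation tower: module A0 §1b ∘ §1 -/

section Assembled

variable (F : T4Family) (K : ℕ) {𝔸 : Type} [NormedRing 𝔸] [NormedAlgebra ℂ 𝔸] {M : ℕ} [NeZero M] (L : ℕ) [NeZero L]

open Classical in
/-- **★ THE GUARD ALONG THE INTERPOLATION TOWER**: along every history slot-wise in `D|i := Ball`, the older terms generated by `TF|i := V i + (s∕ρ)·(TF i …z₀… − V i)` are
(1.18)`(E₀,r₁)`-bounded on the tables AND ANALYTIC THERE, for every step `m ≤ Kr` — from (T-an)[TF] slot-wise on `D` below `Kr`, (T-an)[V i], the (T-226) bound of the interpolation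
family slot-wise on `D|i := Ball` below `Kr` (module R1b proves it already: `haff`∕`hVb`∕`hcen`, weight doubled into `a₅′`), the tables' restriction property, N18's numerals; by module
A0 §1b (dag-n18-c's heredity BY NAME on the frozen family).  What §3 feeds R1aᴬ §2's `hQ`.  (lens Sketch22 §4, ported with attribution.)
[cite: Balaban1987RG1, §1 p.263 ((1.18) and the clause before it) and Thm 1 p.259; Balaban1988RG2Cluster, (2.14) p.15, (2.26) p.17 and p.22] -/
theorem guard_along_interpolation (TF : GenTermFun (F.P K) 𝔸 M L)
    (V : (k : ℕ) → (domSys (F.P K) M (k + 1)).Dom → TermLabel (F.P K) M k L → OlderTerms (F.P K) 𝔸 M k → CPair (F.P K) 𝔸 → ℂ)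
    (D : ℕ → Set ℂ) (sp : (j : ℕ) → (domSys (F.P K) M j).Dom → Set (CPair (F.P K) 𝔸)) {E₀ r₁ : ℝ} (hrestr : ∀ k, SpRestr (sp (k + 1)))
    (c : B13.Consts) (hL : 8 ≤ c.L) (hLc : c.L = L) {a a₂ a₂' a₅ Aabs : ℝ} (hN : Lemma3Numerics c M ((c.L : ℝ) / 2) a a₂ a₂' a₅ Aabs)
    (Kr i : ℕ) (hi : i < Kr) {z₀ : ℂ} (hz₀ : z₀ ∈ D i) (ρ : ℂ) (Ball : Set ℂ)
    (hTan : ∀ k : ℕ, k < Kr → ∀ t ∈ D k, ∀ old : OlderTerms (F.P K) 𝔸 M k,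
      (∀ (j : Fin (k + 1)) (Y : (domSys (F.P K) M j).Dom), ∀ ψ ∈ sp j Y,
          ‖old j Y ψ‖ ≤ E₀ * Real.exp (-(r₁ * (domSys (F.P K) M j).dj Y))) →
      (∀ (j : Fin (k + 1)) (Y : (domSys (F.P K) M j).Dom), AnalyticOnNhd ℂ (old j Y) (sp j Y)) →
      ∀ (Z : (domSys (F.P K) M (k + 1)).Dom), ∀ τ ∈ terms L M Z, AnalyticOnNhd ℂ (fun φ => TF k Z τ t old φ) (sp (k + 1) Z))
    (hVan : ∀ old : OlderTerms (F.P K) 𝔸 M i,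
      (∀ (j : Fin (i + 1)) (Y : (domSys (F.P K) M j).Dom), ∀ ψ ∈ sp j Y,
          ‖old j Y ψ‖ ≤ E₀ * Real.exp (-(r₁ * (domSys (F.P K) M j).dj Y))) →
      (∀ (j : Fin (i + 1)) (Y : (domSys (F.P K) M j).Dom), AnalyticOnNhd ℂ (old j Y) (sp j Y)) →
      ∀ (Z : (domSys (F.P K) M (i + 1)).Dom), ∀ τ ∈ terms L M Z, AnalyticOnNhd ℂ (fun φ => V i Z τ old φ) (sp (i + 1) Z))
    (hT226s : ∀ k : ℕ, k < Kr → ∀ t ∈ Function.update D i Ball k, ∀ old : OlderTerms (F.P K) 𝔸 M k,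
      (∀ (j : Fin (k + 1)) (Y : (domSys (F.P K) M j).Dom), ∀ ψ ∈ sp j Y,
          ‖old j Y ψ‖ ≤ E₀ * Real.exp (-(r₁ * (domSys (F.P K) M j).dj Y))) →
      (∀ (j : Fin (k + 1)) (Y : (domSys (F.P K) M j).Dom), AnalyticOnNhd ℂ (old j Y) (sp j Y)) →
      ∀ (Z : (domSys (F.P K) M (k + 1)).Dom) (φ : CPair (F.P K) 𝔸), φ ∈ sp (k + 1) Z → ∀ τ ∈ terms L M Z,
        ‖Function.update TF i (fun Z τ s old φ => V i Z τ old φ + (s / ρ) * (TF i Z τ z₀ old φ - V i Z τ old φ)) k Z τ t old φ‖ ≤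
          weight L M c Z a τ * Real.exp (a₅ * ((Z.1).card : ℝ)))
    (hr₁ : 0 ≤ r₁) (hA : 0 ≤ c.C3act * c.ε₁) (hrate : r₁ + 2 * (64 * Real.log 162) + 2 ≤ (1 - 8 * c.δ) * ((c.L : ℝ) / 2) * c.κ)
    (hsmall : c.C3act * c.ε₁ * Real.exp (5 * r₁ + 1) * K₀ 64 8 * 9 * 64 < 1)
    (hrenew : Real.exp 1 * 9 * 64 * K₀ 64 8 ^ 2 * (c.C3act * c.ε₁) ≤ E₀) :
    ∀ h : ℕ → ℂ, (∀ n, h n ∈ Function.update D i Ball n) → ∀ m : ℕ, m ≤ Kr →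
      (∀ (j : Fin (m + 1)) (Y : (domSys (F.P K) M j).Dom), ∀ ψ ∈ sp j Y,
          ‖olderOf (recTerm (GenTower.ofTerms L (Function.update TF i (fun Z τ s old φ => V i Z τ old φ + (s / ρ) * (TF i Z τ z₀ old φ - V i Z τ old φ)))) h) m j Y ψ‖ ≤
            E₀ * Real.exp (-(r₁ * (domSys (F.P K) M j).dj Y))) ∧
      (∀ (j : Fin (m + 1)) (Y : (domSys (F.P K) M j).Dom),
          AnalyticOnNhd ℂ (olderOf (recTerm (GenTower.ofTerms L (Function.update TF i (fun Z τ s old φ => V i Z τ old φ + (s / ρ) * (TF i Z τ z₀ old φ - V i Z τ old φ)))) h) m j Y)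
            (sp j Y)) :=
  -- ported from lens Sketch22 §4 (ym-lens-BalabanUVNodes-transfer g22), with attribution
  fun h hh m hm =>
    admissibleBelow_along_of_termwise_family F K L _ (Function.update D i Ball) sp hrestr c hL hLc hN Kr
      (fun k hk => termwiseAn_interpolation L TF V D sp
        (fun k old => ∀ (j : Fin (k + 1)) (Y : (domSys (F.P K) M j).Dom), ∀ ψ ∈ sp j Y, ‖old j Y ψ‖ ≤ E₀ * Real.exp (-(r₁ * (domSys (F.P K) M j).dj Y)))
        (fun k old => ∀ (j : Fin (k + 1)) (Y : (domSys (F.P K) M j).Dom), AnalyticOnNhd ℂ (old j Y) (sp j Y)) i z₀ ρ Ball k (hTan k hk)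
        (fun old => hTan i hi z₀ hz₀ old) hVan)
      hT226s hr₁ hA hrate hsmall hrenew h hh m hm

end Assembled

/-! ## §3 CENTRED HEREDITY OVER THE ADMISSIBLE CLASS: the order-two vertex letter of every generated term in every young coupling, w.r.t. the vertex tower — growth μ = 1 -/

section Centred

variable (F : T4Family) (K : ℕ) {𝔸 : Type} [NormedRing 𝔸] [NormedAlgebra ℂ 𝔸] {M : ℕ} [NeZero M] (L : ℕ) [NeZero L]

open Classical in
/-- **★ THE CENTRED LETTER OF EVERY LEVEL FROM THE GUARDED PER-TERM VERTEX SCHEMA, BY THE INTERPOLATION TOWER.**  Setting of module R1aᴬ §3 at the letter `a₅′` (socket numerals at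
`a₅′`, per-term weight bounds displayed at `a₅` with the slack `2·e^{a₅|Z|} ≤ e^{a₅′|Z|}`), restriction-closed tables `sp`, PLUS: a coupling-BLIND centre functional `V k′ Z t old φ` per
step (lens T13′: typed FREE), (S-226-T′)ᴬ for `TF` at every complex last coupling `u ∈ D k′` AND for `V`, on EVERY open set along every holomorphic (1.18)`(A,κ)`-bounded older-term
curve whose values are ANALYTIC ON THE TABLES pointwise; the CENTRED half of (S-vertex-T′)ᴬ ‖TF k′ Z t z old φ − V k′ Z t old φ‖ ≤ Mv·‖z‖²·weight(t)·e^{a₅|Z|} for `z ∈ D k′` and every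
ADMISSIBLE `old` ((1.18)`(A,κ)` ∧ analytic on the tables); the termwise φ-analyticity schemas (T-an)[TF] (slot-wise on `D`) and (T-an)[V] (every step), at (1.18)`(A,r₁)`-bounded
analytic older terms (dag-n18-c's (T-an) shape); N18's STRICT [KP86] clause.  CONCLUSION VERBATIM as module R1b: at every level `j ≤ Kr`, real window history `g`, young coupling
`i < j`, `X`, `φ ∈ sp j X` and `z₀ ∈ D i` with `0 < Mv`, `z₀ ≠ 0`, `Mv·‖z₀‖² ≤ ½`: ‖recTerm G (↑g|i:=z₀) j X φ − recTerm G_V ↑g j X φ‖ ≤ 2·Mv·‖z₀‖²·A·e^{−κ d_j(X)},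
`G_V := GenTower.ofTerms L (TF | i := V i)` the VERTEX TOWER — UNIFORMLY IN THE AGE `j − i`.  Proof: module R1b's — the interpolation tower `TF | i := (V i + (s∕ρ)·(TF i …z₀… − V i))`,
`ρ := γ + 1`, on the domain family `D | i := ball 0 (ρ∕(Mv‖z₀‖²))` satisfies R1aᴬ §2's GUARDED schemas at the guard «analytic on the tables», its `hQ` being §2 here; so its level-`j`
section in the mock coupling is holomorphic on the ball and bounded by `A·e^{−κd}`; R1b §1 identifies it at `s = ρ` ∕ `s = 0`; the Schwarz lemma gives the letter.
[cite: Balaban1987RG1, §0 p.256, §1 p.263 ((1.18) and the clause before it), (2.9) p.266, (2.10) p.267 and (2.13) p.268; Balaban1988RG2Cluster, (1.41) p.11, (2.14) p.15, (2.26) p.17, (2.39)-(2.41) p.21 and p.22] -/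
theorem centred_recTerm_ofTerms_adm (TF : GenTermFun (F.P K) 𝔸 M L)
    (V : (k : ℕ) → (domSys (F.P K) M (k + 1)).Dom → TermLabel (F.P K) M k L → OlderTerms (F.P K) 𝔸 M k → CPair (F.P K) 𝔸 → ℂ)
    (sp : (j : ℕ) → (domSys (F.P K) M j).Dom → Set (CPair (F.P K) 𝔸)) (hrestr : ∀ k, SpRestr (sp (k + 1)))
    (c : B13.Consts) (hL : 8 ≤ c.L) (hLc : c.L = L) {a a₂ a₂' a₅ a₅' Aabs : ℝ} (hN : Lemma3Numerics c M ((c.L : ℝ) / 2) a a₂ a₂' a₅' Aabs)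
    {γ A κ r₁ Mv : ℝ} (hA0 : 0 ≤ c.C3act * c.ε₁) (hr₁ : 0 ≤ r₁) (hκ : κ ≤ r₁)
    (hrate : r₁ + 2 * (64 * Real.log 162) + 2 ≤ (1 - 8 * c.δ) * ((c.L : ℝ) / 2) * c.κ)
    (hsmall : c.C3act * c.ε₁ * Real.exp (5 * r₁ + 1) * K₀ 64 8 * 9 * 64 < 1)
    (hrenew : Real.exp 1 * 9 * 64 * K₀ 64 8 ^ 2 * (c.C3act * c.ε₁) ≤ A)
    (h2w : ∀ (k' : ℕ) (Z : (domSys (F.P K) M (k' + 1)).Dom), 2 * Real.exp (a₅ * ((Z.1).card : ℝ)) ≤ Real.exp (a₅' * ((Z.1).card : ℝ)))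
    (D : ℕ → Set ℂ) (hDo : ∀ i, IsOpen (D i)) (hDw : ∀ (i : ℕ), ∀ t ∈ Ioc (0 : ℝ) γ, ((t : ℝ) : ℂ) ∈ D i) (Kr : ℕ)
    (hTanD : ∀ k' : ℕ, k' < Kr → ∀ t ∈ D k', ∀ old : OlderTerms (F.P K) 𝔸 M k',
      (∀ (j : Fin (k' + 1)) (Y : (domSys (F.P K) M j).Dom), ∀ ψ ∈ sp j Y,
          ‖old j Y ψ‖ ≤ A * Real.exp (-(r₁ * (domSys (F.P K) M j).dj Y))) →
      (∀ (j : Fin (k' + 1)) (Y : (domSys (F.P K) M j).Dom), AnalyticOnNhd ℂ (old j Y) (sp j Y)) →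
      ∀ (Z : (domSys (F.P K) M (k' + 1)).Dom), ∀ τ ∈ terms L M Z, AnalyticOnNhd ℂ (fun φ => TF k' Z τ t old φ) (sp (k' + 1) Z))
    (hVanD : ∀ k' : ℕ, k' < Kr → ∀ old : OlderTerms (F.P K) 𝔸 M k',
      (∀ (j : Fin (k' + 1)) (Y : (domSys (F.P K) M j).Dom), ∀ ψ ∈ sp j Y,
          ‖old j Y ψ‖ ≤ A * Real.exp (-(r₁ * (domSys (F.P K) M j).dj Y))) →
      (∀ (j : Fin (k' + 1)) (Y : (domSys (F.P K) M j).Dom), AnalyticOnNhd ℂ (old j Y) (sp j Y)) →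
      ∀ (Z : (domSys (F.P K) M (k' + 1)).Dom), ∀ τ ∈ terms L M Z, AnalyticOnNhd ℂ (fun φ => V k' Z τ old φ) (sp (k' + 1) Z))
    (hlast : ∀ k' : ℕ, k' < Kr → ∀ old : OlderTerms (F.P K) 𝔸 M k',
      (∀ (j : Fin (k' + 1)) (Y : (domSys (F.P K) M j).Dom) (ψ : CPair (F.P K) 𝔸), ψ ∈ sp j Y → ‖old j Y ψ‖ ≤ A * Real.exp (-(κ * torusTreeLen Y.1))) →
      (∀ (j : Fin (k' + 1)) (Y : (domSys (F.P K) M j).Dom), AnalyticOnNhd ℂ (old j Y) (sp j Y)) →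
      ∀ (X : (domSys (F.P K) M (k' + 1)).Dom) (φ : CPair (F.P K) 𝔸), φ ∈ sp (k' + 1) X → ∀ (Z : (domSys (F.P K) M (k' + 1)).Dom), Z.1 ⊆ X.1 → ∀ t ∈ terms L M Z,
        DifferentiableOn ℂ (fun z => TF k' Z t z old φ) (D k') ∧ ∀ z ∈ D k', ‖TF k' Z t z old φ‖ ≤ weight L M c Z a t * Real.exp (a₅ * ((Z.1).card : ℝ)))
    (hprop : ∀ k' : ℕ, k' < Kr → ∀ i : ℕ, i < k' → ∀ (O : Set ℂ), IsOpen O → ∀ u ∈ D k', ∀ cv : ℂ → OlderTerms (F.P K) 𝔸 M k',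
      (∀ (j : Fin (k' + 1)) (Y : (domSys (F.P K) M j).Dom) (ψ : CPair (F.P K) 𝔸), ψ ∈ sp j Y →
        DifferentiableOn ℂ (fun z => cv z j Y ψ) O ∧ ∀ z ∈ O, ‖cv z j Y ψ‖ ≤ A * Real.exp (-(κ * torusTreeLen Y.1))) →
      (∀ z ∈ O, ∀ (j : Fin (k' + 1)) (Y : (domSys (F.P K) M j).Dom), AnalyticOnNhd ℂ (cv z j Y) (sp j Y)) →
      ∀ (X : (domSys (F.P K) M (k' + 1)).Dom) (φ : CPair (F.P K) 𝔸), φ ∈ sp (k' + 1) X → ∀ (Z : (domSys (F.P K) M (k' + 1)).Dom), Z.1 ⊆ X.1 → ∀ t ∈ terms L M Z,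
        DifferentiableOn ℂ (fun z => TF k' Z t u (cv z) φ) O ∧ ∀ z ∈ O, ‖TF k' Z t u (cv z) φ‖ ≤ weight L M c Z a t * Real.exp (a₅ * ((Z.1).card : ℝ)))
    (hpropV : ∀ k' : ℕ, k' < Kr → ∀ (O : Set ℂ), IsOpen O → ∀ cv : ℂ → OlderTerms (F.P K) 𝔸 M k',
      (∀ (j : Fin (k' + 1)) (Y : (domSys (F.P K) M j).Dom) (ψ : CPair (F.P K) 𝔸), ψ ∈ sp j Y →
        DifferentiableOn ℂ (fun z => cv z j Y ψ) O ∧ ∀ z ∈ O, ‖cv z j Y ψ‖ ≤ A * Real.exp (-(κ * torusTreeLen Y.1))) →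
      (∀ z ∈ O, ∀ (j : Fin (k' + 1)) (Y : (domSys (F.P K) M j).Dom), AnalyticOnNhd ℂ (cv z j Y) (sp j Y)) →
      ∀ (X : (domSys (F.P K) M (k' + 1)).Dom) (φ : CPair (F.P K) 𝔸), φ ∈ sp (k' + 1) X → ∀ (Z : (domSys (F.P K) M (k' + 1)).Dom), Z.1 ⊆ X.1 → ∀ t ∈ terms L M Z,
        DifferentiableOn ℂ (fun z => V k' Z t (cv z) φ) O ∧ ∀ z ∈ O, ‖V k' Z t (cv z) φ‖ ≤ weight L M c Z a t * Real.exp (a₅ * ((Z.1).card : ℝ)))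
    (hcen : ∀ k' : ℕ, k' < Kr → ∀ old : OlderTerms (F.P K) 𝔸 M k',
      (∀ (j : Fin (k' + 1)) (Y : (domSys (F.P K) M j).Dom) (ψ : CPair (F.P K) 𝔸), ψ ∈ sp j Y → ‖old j Y ψ‖ ≤ A * Real.exp (-(κ * torusTreeLen Y.1))) →
      (∀ (j : Fin (k' + 1)) (Y : (domSys (F.P K) M j).Dom), AnalyticOnNhd ℂ (old j Y) (sp j Y)) →
      ∀ (X : (domSys (F.P K) M (k' + 1)).Dom) (φ : CPair (F.P K) 𝔸), φ ∈ sp (k' + 1) X → ∀ (Z : (domSys (F.P K) M (k' + 1)).Dom), Z.1 ⊆ X.1 → ∀ t ∈ terms L M Z,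
        ∀ z ∈ D k', ‖TF k' Z t z old φ - V k' Z t old φ‖ ≤ Mv * ‖z‖ ^ 2 * (weight L M c Z a t * Real.exp (a₅ * ((Z.1).card : ℝ))))
    (hMv : 0 < Mv) :
    ∀ (j : ℕ), j ≤ Kr → ∀ (g : ℕ → ℝ), g ∈ Window γ → ∀ (i : ℕ), i < j → ∀ (X : (domSys (F.P K) M j).Dom) (φ : CPair (F.P K) 𝔸), φ ∈ sp j X →
      ∀ z₀ ∈ D i, z₀ ≠ 0 → Mv * ‖z₀‖ ^ 2 ≤ 1 / 2 →
        ‖recTerm (GenTower.ofTerms L TF) (Function.update (fun n => ((g n : ℝ) : ℂ)) i z₀) j X φ -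
            recTerm (GenTower.ofTerms L (Function.update TF i fun Z t _ old φ => V i Z t old φ)) (fun n => ((g n : ℝ) : ℂ)) j X φ‖ ≤
          2 * (Mv * ‖z₀‖ ^ 2) * (A * Real.exp (-(κ * torusTreeLen X.1))) := by
  intro j hj g hg i hij X φ hφ z₀ hz₀ hz₀ne hq
  have hA6 : 0 ≤ c.α₆ * c.eps2 := mul_nonneg hN.hα₆.le hN.hε₀
  have hApos : 0 ≤ A := le_trans (by positivity) hrenew
  have hγ : 0 < γ := (hg 0).1.trans_le (hg 0).2
  have hiK : i < Kr := lt_of_lt_of_le hij hj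
  -- class conversion: (1.18)`(A,r₁)` read with `d_j` ⟹ (1.18)`(A,κ)` read with `torusTreeLen`
  have hconv : ∀ (k' : ℕ) (old : OlderTerms (F.P K) 𝔸 M k'),
      (∀ (j : Fin (k' + 1)) (Y : (domSys (F.P K) M j).Dom), ∀ ψ ∈ sp j Y, ‖old j Y ψ‖ ≤ A * Real.exp (-(r₁ * (domSys (F.P K) M j).dj Y))) →
      ∀ (j : Fin (k' + 1)) (Y : (domSys (F.P K) M j).Dom) (ψ : CPair (F.P K) 𝔸), ψ ∈ sp j Y → ‖old j Y ψ‖ ≤ A * Real.exp (-(κ * torusTreeLen Y.1)) := by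
    intro k' old hB j Y ψ hψ
    refine (hB j Y ψ hψ).trans (mul_le_mul_of_nonneg_left (Real.exp_le_exp.mpr ?_) hApos)
    show -(r₁ * torusTreeLen Y.1) ≤ -(κ * torusTreeLen Y.1)
    exact neg_le_neg (mul_le_mul_of_nonneg_right hκ (torusTreeLen_nonneg Y.1))
  -- letters of the interpolation
  set q : ℝ := Mv * ‖z₀‖ ^ 2 with hqdef
  have hq0 : 0 < q := mul_pos hMv (pow_pos (norm_pos_iff.mpr hz₀ne) 2)
  set ρ : ℝ := γ + 1 with hρdef
  have hρ0 : 0 < ρ := by positivity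
  set R : ℝ := ρ / q with hRdef
  have hR0 : 0 < R := div_pos hρ0 hq0
  have hRρ : R * q = ρ := div_mul_cancel₀ ρ hq0.ne'
  have hρR : ρ < R := by
    rw [hRdef, lt_div_iff₀ hq0]
    nlinarith
  have hγR : γ < R := by linarith
  -- the upgraded weight letter
  have hexp : ∀ (k' : ℕ) (Z : (domSys (F.P K) M (k' + 1)).Dom), Real.exp (a₅ * ((Z.1).card : ℝ)) ≤ Real.exp (a₅' * ((Z.1).card : ℝ)) := fun k' Z =>
    le_trans (by linarith [Real.exp_pos (a₅ * ((Z.1).card : ℝ))]) (h2w k' Z)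
  have hw_up : ∀ (k' : ℕ) (Z : (domSys (F.P K) M (k' + 1)).Dom) (t : TermLabel (F.P K) M k' L) (x : ℝ),
      x ≤ weight L M c Z a t * Real.exp (a₅ * ((Z.1).card : ℝ)) → x ≤ weight L M c Z a t * Real.exp (a₅' * ((Z.1).card : ℝ)) := fun k' Z t x hx =>
    hx.trans (mul_le_mul_of_nonneg_left (hexp k' Z) (weight_nonneg c Z a hA6 t))
  have hw_two : ∀ (k' : ℕ) (Z : (domSys (F.P K) M (k' + 1)).Dom) (t : TermLabel (F.P K) M k' L) (x : ℝ),
      x ≤ 2 * (weight L M c Z a t * Real.exp (a₅ * ((Z.1).card : ℝ))) → x ≤ weight L M c Z a t * Real.exp (a₅' * ((Z.1).card : ℝ)) := fun k' Z t x hx =>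
    hx.trans (by
      calc 2 * (weight L M c Z a t * Real.exp (a₅ * ((Z.1).card : ℝ))) = weight L M c Z a t * (2 * Real.exp (a₅ * ((Z.1).card : ℝ))) := by ring
        _ ≤ weight L M c Z a t * Real.exp (a₅' * ((Z.1).card : ℝ)) := mul_le_mul_of_nonneg_left (h2w k' Z) (weight_nonneg c Z a hA6 t))
  -- the uncentred bound of the centre at an admissible older-term family (from (S-226-T′)ᴬ for `V` along a constant curve)
  have hVb : ∀ k' : ℕ, k' < Kr → ∀ old : OlderTerms (F.P K) 𝔸 M k',
      (∀ (j : Fin (k' + 1)) (Y : (domSys (F.P K) M j).Dom) (ψ : CPair (F.P K) 𝔸), ψ ∈ sp j Y → ‖old j Y ψ‖ ≤ A * Real.exp (-(κ * torusTreeLen Y.1))) →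
      (∀ (j : Fin (k' + 1)) (Y : (domSys (F.P K) M j).Dom), AnalyticOnNhd ℂ (old j Y) (sp j Y)) →
      ∀ (X : (domSys (F.P K) M (k' + 1)).Dom) (φ : CPair (F.P K) 𝔸), φ ∈ sp (k' + 1) X → ∀ (Z : (domSys (F.P K) M (k' + 1)).Dom), Z.1 ⊆ X.1 → ∀ t ∈ terms L M Z,
        ‖V k' Z t old φ‖ ≤ weight L M c Z a t * Real.exp (a₅ * ((Z.1).card : ℝ)) := fun k' hk old hold han X φ hφ Z hZ t ht =>
    ((hpropV k' hk univ isOpen_univ (fun _ => old) (fun j Y ψ hψ => ⟨differentiableOn_const _, fun _ _ => hold j Y ψ hψ⟩) (fun _ _ => han) X φ hφ Z hZ t ht).2 0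
      (mem_univ _))
  -- THE INTERPOLATION TOWER and its domain family
  set TFs : GenTermFun (F.P K) 𝔸 M L :=
    Function.update TF i (fun Z t s old φ => V i Z t old φ + (s / (ρ : ℂ)) * (TF i Z t z₀ old φ - V i Z t old φ)) with hTFs
  set Ds : ℕ → Set ℂ := Function.update D i (ball (0 : ℂ) R) with hDs
  have hTFs_i : TFs i = fun Z t s old φ => V i Z t old φ + (s / (ρ : ℂ)) * (TF i Z t z₀ old φ - V i Z t old φ) := by rw [hTFs, Function.update_self]
  have hTFs_ne : ∀ k' : ℕ, k' ≠ i → TFs k' = TF k' := fun k' hk => by rw [hTFs, Function.update_of_ne hk]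
  have hDs_i : Ds i = ball (0 : ℂ) R := by rw [hDs, Function.update_self]
  have hDs_ne : ∀ k' : ℕ, k' ≠ i → Ds k' = D k' := fun k' hk => by rw [hDs, Function.update_of_ne hk]
  have hDso : ∀ i', IsOpen (Ds i') := fun i' => by
    by_cases h : i' = i
    · subst h; rw [hDs_i]; exact isOpen_ball
    · rw [hDs_ne i' h]; exact hDo i'
  have hDsw : ∀ (i' : ℕ), ∀ t ∈ Ioc (0 : ℝ) γ, ((t : ℝ) : ℂ) ∈ Ds i' := fun i' t ht => by
    by_cases h : i' = i
    · subst h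
      rw [hDs_i, mem_ball, dist_zero_right, Complex.norm_real, Real.norm_eq_abs, abs_of_pos ht.1]
      exact ht.2.trans_lt hγR
    · rw [hDs_ne i' h]; exact hDw i' t ht
  -- the norm of the affine combination on the ball: at most twice the weight
  have haff : ∀ (s : ℂ), ‖s‖ ≤ R → ∀ (x y w : ℂ) (wt : ℝ), ‖y‖ ≤ wt → ‖x - y‖ ≤ q * wt → ‖y + s / (ρ : ℂ) * (x - y)‖ ≤ 2 * wt := by
    intro s hs x y w wt hy hxy
    have hwt : 0 ≤ wt := (norm_nonneg _).trans hy
    have h1 : ‖s / (ρ : ℂ) * (x - y)‖ ≤ R / ρ * (q * wt) := by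
      rw [norm_mul, norm_div, Complex.norm_real, Real.norm_eq_abs, abs_of_pos hρ0]
      exact mul_le_mul (div_le_div_of_nonneg_right hs hρ0.le) hxy (norm_nonneg _) (div_nonneg hR0.le hρ0.le)
    have h2 : R / ρ * (q * wt) = wt := by
      rw [← hRρ]; field_simp
    calc ‖y + s / (ρ : ℂ) * (x - y)‖ ≤ ‖y‖ + ‖s / (ρ : ℂ) * (x - y)‖ := norm_add_le _ _
      _ ≤ wt + wt := add_le_add hy (h1.trans h2.le)
      _ = 2 * wt := by ring
  -- (S-last-T′)ᴬ for the interpolation tower at the letter `a₅′` (holomorphy in the mock coupling is affine; the bound is at most twice the weight)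
  have hlastS : ∀ k' : ℕ, k' < Kr → ∀ old : OlderTerms (F.P K) 𝔸 M k',
      (∀ (j : Fin (k' + 1)) (Y : (domSys (F.P K) M j).Dom) (ψ : CPair (F.P K) 𝔸), ψ ∈ sp j Y → ‖old j Y ψ‖ ≤ A * Real.exp (-(κ * torusTreeLen Y.1))) →
      (∀ (j : Fin (k' + 1)) (Y : (domSys (F.P K) M j).Dom), AnalyticOnNhd ℂ (old j Y) (sp j Y)) →
      ∀ (X : (domSys (F.P K) M (k' + 1)).Dom) (φ : CPair (F.P K) 𝔸), φ ∈ sp (k' + 1) X → ∀ (Z : (domSys (F.P K) M (k' + 1)).Dom), Z.1 ⊆ X.1 → ∀ t ∈ terms L M Z,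
        DifferentiableOn ℂ (fun z => TFs k' Z t z old φ) (Ds k') ∧ ∀ z ∈ Ds k', ‖TFs k' Z t z old φ‖ ≤ weight L M c Z a t * Real.exp (a₅' * ((Z.1).card : ℝ)) := by
    intro k' hk old hold han X' φ' hφ' Z hZ t ht
    by_cases hki : k' = i
    · subst hki
      rw [hTFs_i, hDs_i]
      refine ⟨?_, fun s hs => ?_⟩
      · exact ((differentiableOn_const _).add ((differentiableOn_id.div_const _).mul (differentiableOn_const _)))
      · refine hw_two k' Z t _ (haff s ?_ _ _ 0 _ (hVb k' hk old hold han X' φ' hφ' Z hZ t ht) (hcen k' hk old hold han X' φ' hφ' Z hZ t ht z₀ hz₀))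
        rw [mem_ball, dist_zero_right] at hs
        exact hs.le
    · rw [hTFs_ne k' hki, hDs_ne k' hki]
      obtain ⟨hd, hb⟩ := hlast k' hk old hold han X' φ' hφ' Z hZ t ht
      exact ⟨hd, fun z hz => hw_up k' Z t _ (hb z hz)⟩
  -- R1aᴬ §2 for the interpolation tower at the letter `a₅′`, guard «analytic on the tables», `hQ` from §2
  have H1 := holoBound_recTerm_ofTerms_guarded F K L TFs sp
    (fun k' old => ∀ (j : Fin (k' + 1)) (Y : (domSys (F.P K) M j).Dom), AnalyticOnNhd ℂ (old j Y) (sp j Y))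
    c hL hLc hN hA0 hr₁ hκ hrate hsmall.le hrenew Ds hDso hDsw Kr ?_ hlastS ?_
  rotate_left
  · -- `hQ` along the interpolation tower: §2 (module A0 §1b ∘ §1); its (T-226) input is `hlastS`.2 at `X := Z`
    intro h hh k' hk'
    have hh' : ∀ n, h n ∈ Function.update D i (ball (0 : ℂ) R) n := fun n => by rw [← hDs]; exact hh n
    refine (guard_along_interpolation F K L TF V D sp hrestr c hL hLc hN Kr i hiK hz₀ (ρ : ℂ) (ball (0 : ℂ) R) hTanD (hVanD i hiK) ?_ hr₁ hA0 hrate hsmall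
      hrenew h hh' k' hk'.le).2
    intro k hk t ht old hB hAn Z φ' hφ' τ hτ
    have ht' : t ∈ Ds k := by rw [hDs]; exact ht
    have h' := (hlastS k hk old (hconv k old hB) hAn Z φ' hφ' Z (Finset.Subset.refl _) τ hτ).2 t ht'
    rw [hTFs] at h'
    exact h'
  · -- (S-226-T′)ᴬ for the interpolation tower
    intro k' hk i' hi' u hu cv hcv hcvA X' φ' hφ' Z hZ t ht
    have hcvb : ∀ z ∈ Ds i', ∀ (j : Fin (k' + 1)) (Y : (domSys (F.P K) M j).Dom) (ψ : CPair (F.P K) 𝔸), ψ ∈ sp j Y →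
        ‖cv z j Y ψ‖ ≤ A * Real.exp (-(κ * torusTreeLen Y.1)) := fun z hz j Y ψ hψ => (hcv j Y ψ hψ).2 z hz
    by_cases hki : k' = i
    · subst hki
      have hi'ne : i' ≠ k' := Nat.ne_of_lt hi'
      rw [hTFs_i]
      rw [hDs_i, mem_ball, dist_zero_right] at hu
      rw [hDs_ne i' hi'ne] at hcv hcvA hcvb ⊢
      obtain ⟨hVd, hVbd⟩ := hpropV k' hk (D i') (hDo i') cv hcv hcvA X' φ' hφ' Z hZ t ht
      obtain ⟨hTd, -⟩ := hprop k' hk i' hi' (D i') (hDo i') z₀ hz₀ cv hcv hcvA X' φ' hφ' Z hZ t ht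
      refine ⟨hVd.add ((differentiableOn_const _).mul (hTd.sub hVd)), fun z hz => ?_⟩
      exact hw_two k' Z t _ (haff u hu.le _ _ 0 _ (hVbd z hz) (hcen k' hk (cv z) (hcvb z hz) (hcvA z hz) X' φ' hφ' Z hZ t ht z₀ hz₀))
    · rw [hTFs_ne k' hki]
      rw [hDs_ne k' hki] at hu
      obtain ⟨hd, hb⟩ := hprop k' hk i' hi' (Ds i') (hDso i') u hu cv hcv hcvA X' φ' hφ' Z hZ t ht
      exact ⟨hd, fun z hz => hw_up k' Z t _ (hb z hz)⟩
  -- the section of the interpolation tower in the mock coupling: holomorphic on the ball, bounded by `A e^{−κ d}`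
  obtain ⟨-, hsec⟩ := H1 j hj g hg X φ hφ
  obtain ⟨hhol, hbd⟩ := hsec i hij
  rw [hDs_i] at hhol hbd
  set gc : ℕ → ℂ := fun n => ((g n : ℝ) : ℂ) with hgc
  set Φ : ℂ → ℂ := fun s => recTerm (GenTower.ofTerms L TFs) (Function.update gc i s) j X φ with hΦ
  -- its values at the two mock couplings
  have hΦρ : Φ (ρ : ℂ) = recTerm (GenTower.ofTerms L TF) (Function.update gc i z₀) j X φ := by
    refine recTerm_ofTerms_congr_step F K L i hTFs_ne (fun n hn => by rw [Function.update_of_ne hn, Function.update_of_ne hn]) (fun Z t old φ => ?_) j X φ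
    rw [hTFs_i, Function.update_self, Function.update_self]
    have hρc : (ρ : ℂ) ≠ 0 := Complex.ofReal_ne_zero.mpr hρ0.ne'
    field_simp
    ring
  have hΦ0 : Φ 0 = recTerm (GenTower.ofTerms L (Function.update TF i fun Z t _ old φ => V i Z t old φ)) gc j X φ := by
    refine recTerm_ofTerms_congr_step F K L i (fun k' hk => by rw [hTFs_ne k' hk, Function.update_of_ne hk])
      (fun n hn => by rw [Function.update_of_ne hn]) (fun Z t old φ => ?_) j X φ
    rw [hTFs_i, Function.update_self, Function.update_self]
    simp
  -- the Schwarz lemma on `ball 0 R`: the section maps the ball into the closed `2A e^{−κd}`-ball about its value at `0`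
  have hB0 : ‖Φ 0‖ ≤ A * Real.exp (-(κ * torusTreeLen X.1)) := hbd 0 (mem_ball_self hR0)
  have hmaps : MapsTo Φ (ball (0 : ℂ) R) (closedBall (Φ 0) (2 * (A * Real.exp (-(κ * torusTreeLen X.1))))) := fun s hs => by
    rw [mem_closedBall, dist_eq_norm]
    calc ‖Φ s - Φ 0‖ ≤ ‖Φ s‖ + ‖Φ 0‖ := norm_sub_le _ _
      _ ≤ A * Real.exp (-(κ * torusTreeLen X.1)) + A * Real.exp (-(κ * torusTreeLen X.1)) := add_le_add (hbd s hs) hB0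
      _ = 2 * (A * Real.exp (-(κ * torusTreeLen X.1))) := by ring
  have hρball : ((ρ : ℝ) : ℂ) ∈ ball (0 : ℂ) R := by
    rw [mem_ball, dist_zero_right, Complex.norm_real, Real.norm_eq_abs, abs_of_pos hρ0]
    exact hρR
  have key := Complex.dist_le_div_mul_dist_of_mapsTo_ball hhol hmaps hρball
  rw [dist_eq_norm, dist_zero_right, Complex.norm_real, Real.norm_eq_abs, abs_of_pos hρ0, hΦρ, hΦ0] at key
  calc ‖recTerm (GenTower.ofTerms L TF) (Function.update gc i z₀) j X φ -
          recTerm (GenTower.ofTerms L (Function.update TF i fun Z t _ old φ => V i Z t old φ)) gc j X φ‖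
      ≤ 2 * (A * Real.exp (-(κ * torusTreeLen X.1))) / R * ρ := key
    _ = 2 * (Mv * ‖z₀‖ ^ 2) * (A * Real.exp (-(κ * torusTreeLen X.1))) := by
        rw [← hqdef, hRdef]
        field_simp

end Centred

end YMDAG.N22.W1

end
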